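import Summits.QuantumFields.YangMills.Theorems.BalabanUVNodesN11TopPairRoughWitness
import Summits.QuantumFields.YangMills.Theorems.BalabanUVNodesN11ChiTopRegularity

/-!
# DAG node N11 — THE ROUGH COARSE FIELDS LIE ENTIRELY ON def-R's UNIT BRANCH: a `2εreg`-rough coarse field has a χ₁-cube whose local problem (2.12) is UNSOLVABLE (def-R's class is the
# globally `εregη₁²`-regular fine fields, whose averages are `2εreg`-regular by [B7] Prop. 2 — dag-n20-c ∕ g8's `not_solvable_of_roughAt`, plus the cube cover); equivalently: WHERE EVERY
# CUBE IS SOLVABLE NO COARSE FIELD IS ROUGH — so the repair (a′) «zero branch ∕ solvability guard» of `…N11TopPairLocalResidual`'s census EMPTIES the rough part of the support that drives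
# the test of g18 G∕H and g19 A–F (count-neutral, LOCATED; kernel certificate for the repair census)

HEADER — WORK-UNIT METADATA.  Cell `pub-ymgap`, YM-PLAN Track A (HUMAN RULING D-0062), seat `pub-ymgap-dag-n11-d` (g19; N11 [B14], s2), route `BalabanUVNodes`, item K1⁹ =
stmt-QuantumFields-27364 (helper lane, `--kind proof --supports 27364 --as helper`, count-neutral).  [III] = [Balaban1988Convergent], [B7] = [Balaban1985Averaging], [15] =
[Balaban1985Variational].  Over g8's `…N11AllSmallEmptyExtUnitBranch.not_solvable_of_roughAt` (dag-n20-c's `dist1_plaqHol_lt_of_solvable`: a (2.12) minimiser lies in def-R's class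
`{U | PlaqSmall (εreg·η_{k+1}²) U}` and its averages agree with the data on `𝐁(□′^{∼4})`, so the data are `2εreg`-regular on the cornered plaquettes of `□′^{∼3}`), g12's
`…N11ChiTopRegularity.corners_mem_pts_cubeEnl` (corners of a plaquette touching `□^{∼n}` lie in `□^{∼n′}` for `n·S + 2·L^k ≤ n′·S`), r12's cube cover (`B15Claim189CubePin.cubeOfSite`,
`mem_cubeEnl_cubeOfSite`), def-R's (2.12)∕(2.16) objects (`B15DeterminingSets.IsMinimizer`, `B14.Eq213DetSet.Bj`, `qsstarGIter0`).

WHY THIS FILE.  The test of g18 G∕H and g19 A–F bites on `{V′ | χ₁(s′)V′ ≠ 0 ∧ ¬PlaqSmall (2α₀(Lη₁)²) V′}` — rough coarse fields INSIDE the support of the top pair — which is non-null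
because def-R's localized background falls back to the UNIT configuration where (2.12) has no minimiser, making every (3.2) indicator `= 1` there (g8).  This file proves the converse
inclusion behind repair (a′) of `…N11TopPairLocalResidual`'s census: at `α₀ = εreg` (where `(L·η₁)² = 1`), EVERY `2εreg`-rough coarse field `V′` — in the support or not — has a χ₁-cube
`□′` at which (2.12) is unsolvable (§2): take the cube of the rough plaquette's base point; its three corners lie in `pts 1 (□′^{∼3})` (cube cover + g12's collar lemma, `2L ≤ 3·sideχ`);
g8's `not_solvable_of_roughAt`.  Hence (§3) where every cube is solvable the coarse field is `2εreg`-regular, the rough set is contained in the unit branch, and a (3.2) indicator with a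
ZERO branch (or a solvability guard in the support clause) has NO rough field in its support — the test of A–F is then void, exactly as the census says.  Nothing is edited; the
repaired indicator is not defined here (type owners: def-R ∕ n02-b ∕ def-T).

WHAT THIS FILE PROVES (0 `def`, 0 `sorry`, standard axioms).  §1 `L_mul_eta_one` (`L·η₁ = 1`) · `exists_cube_corners_mem_pts_three` (every level-1 plaquette has its three read corners in
`pts 1 (□′^{∼3})` for the χ₁-cube `□′` of its base point; `0 < sideχ`, `2·L ≤ 3·sideχ`).  §2 ★★★ `exists_not_solvable_of_le_dist1` (one plaquette with `2εreg ≤ |V′(∂q) − 1|` ⇒ an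
unsolvable cube) · ★★★ `exists_not_solvable_of_not_plaqSmall` (`¬PlaqSmall (2εreg(Lη₁)²) V′` ⇒ an unsolvable cube).  §3 ★★★★ `plaqSmall_of_forall_solvable` (every cube solvable ⇒ `V′` is
`2εreg(Lη₁)²`-regular) · ★★★★ `rough_support_subset_unitBranch` (the test set of A–F at `α₀ = εreg` is contained in `{V′ | ∃ □′, ¬solvable}`) · ★★★★ `solvable_rough_support_eq_empty` (its
intersection with «every cube solvable» is EMPTY).

HONEST FRAMING.  Kernel bookkeeping over def-R's ∕ dag-n20-c's ∕ g8's ∕ g12's theorems (count-neutral, LOCATED): nothing of Bałaban asserted or refuted ([15]'s existence theorem is NOT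
used or claimed — solvability is a hypothesis ∕ conclusion about the tree's `IsMinimizer`); no definition edited or proposed; N11 NOT discharged; K1⁹ NOT closed; no registered stub touched;
counts unmoved (typed 28∕28 · discharged 6∕27 · A 6∕28); NOT ℝ⁴ ∕ OS ∕ mass gap ∕ Clay.  No `sorry`, `axiom`, `def`, `instance`, `notation`.  Sources (SHAPE only): [III] (2.12)–(2.13)
pp.256–257, (2.16)–(2.17) p.257, (3.2) p.265; [B7] Prop. 2 (52)–(54) p.26; [15] Thm 1 p.279 (context only).
-/

noncomputable section

open MeasureTheory
open scoped BigOperators Matrix.Norms.L2Operator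

namespace Summit.QuantumFields.YangMills.Theorems.BalabanUVNodesN11RoughSupportOnUnitBranch

open Literature.MathematicalPhysics.QuantumFieldTheory.Balaban1983to89 T4Continuum Node00 B14.Sect3Decomp
open Literature.MathematicalPhysics.QuantumFieldTheory.Balaban1983to89.ExpMeanLog (deltaSU)
open Literature.MathematicalPhysics.QuantumFieldTheory.BalabanImbrieJaffe1984to88.BIJ85Eq453GaugeField (qsstarGIter0)
open B15DeterminingSets (pts mem_pts embIter IsMinimizer avgFamily)
open B14.Eq213DetSet (Bj)
open B14.Eq213MaximalDomains (side)
open B15Claim189CubePin (cubeOfSite cubeOfSite_mem_cubeIndices mem_cubeEnl_cubeOfSite)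
open B8Eq17ClassAkV1 (plaqsOf)
open GaugeField (plaqHol)
open BalabanUVNodesN11AllSmallEmptyExtUnitBranch (not_solvable_of_roughAt)
open BalabanUVNodesN11ChiTopRegularity (corners_mem_pts_cubeEnl)

variable {F : T4Family} {N : ℕ} [NeZero N]

/-! ## §1. Lattice bookkeeping: `L·η₁ = 1`; every level-1 plaquette is cornered in `pts 1 (□′^{∼3})` of the χ₁-cube of its base point -/

section Geometry

variable (ν : Stage7Numerics) (p : B12.RunParams) (g : ℕ → ℝ)

/-- `L · η₁ = 1` (`η_k = L^{−k}`). [cite: Balaban1987RG1, (0.1) p.251 (bookkeeping)] -/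
theorem L_mul_eta_one : ((F.P p.K).L : ℝ) ^ 1 * (F.P p.K).eta 1 = 1 := by
  have hL : (0 : ℝ) < (F.P p.K).L := by exact_mod_cast (F.P p.K).L_pos
  rw [Params.eta, pow_one, pow_one, mul_inv_cancel₀ hL.ne']

/-- **EVERY LEVEL-1 PLAQUETTE IS CORNERED IN `pts 1 (□′^{∼3})` FOR THE χ₁-CUBE `□′` OF ITS BASE POINT** (`0 < sideχ`, `2·L ≤ 3·sideχ`): the base point's level-0 image lies in its own cube
(`mem_cubeEnl_cubeOfSite`), so the plaquette touches `pts 1 □′`, and g12's collar lemma moves the three read corners into `□′^{∼3}`. [cite: Balaban1988Convergent, (2.17) p.257; Balaban1987RG1, (0.1) p.251] -/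
theorem exists_cube_corners_mem_pts_three (hχ : 0 < sideχ F ν p g 0) (hL : 2 * (F.P p.K).L ≤ 3 * sideχ F ν p g 0) (q : Plaq (F.P p.K) 1) :
    ∃ c : Iχ F ν p g 0, q.src ∈ pts 1 (cubeEnl (F.P p.K) (sideχ F ν p g 0) c 3) ∧ q.src.shift q.μ ∈ pts 1 (cubeEnl (F.P p.K) (sideχ F ν p g 0) c 3) ∧
      q.src.shift q.ν ∈ pts 1 (cubeEnl (F.P p.K) (sideχ F ν p g 0) c 3) := by
  refine ⟨⟨cubeOfSite (sideχ F ν p g 0) (embIter 1 q.src), cubeOfSite_mem_cubeIndices (sideχ F ν p g 0) hχ _⟩, ?_⟩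
  have hp : q ∈ plaqsOf (pts 1 (cubeEnl (F.P p.K) (sideχ F ν p g 0) (cubeOfSite (sideχ F ν p g 0) (embIter 1 q.src)) 0)) :=
    Or.inl (mem_pts.2 (mem_cubeEnl_cubeOfSite (sideχ F ν p g 0) hχ (embIter 1 q.src)))
  exact corners_mem_pts_cubeEnl (sideχ F ν p g 0) (cubeOfSite (sideχ F ν p g 0) (embIter 1 q.src)) (n := 0) (n' := 3) (k := 1)
    (by rw [zero_mul, zero_add, pow_one]; exact hL) hp

/-- The grid condition `3·L·M₁ ≤ sideχ` with `1 ≤ M₁` gives `2·L ≤ 3·sideχ`. [cite: Balaban1988Convergent, (2.13) pp.256–257 (bookkeeping)] -/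
theorem two_mul_L_le_of_grid (hM1 : 1 ≤ ν.M₁) (h3 : 3 * side (F.P p.K).L ν.M₁ 1 ≤ sideχ F ν p g 0) : 2 * (F.P p.K).L ≤ 3 * sideχ F ν p g 0 := by
  have hside : (F.P p.K).L ≤ side (F.P p.K).L ν.M₁ 1 := by
    show (F.P p.K).L ≤ (F.P p.K).L ^ 1 * ν.M₁
    rw [pow_one]; exact Nat.le_mul_of_pos_right _ hM1
  omega

end Geometry

/-! ## §2. A rough coarse field has an unsolvable cube -/

section Unsolvable

variable (ν : Stage7Numerics) (p : B12.RunParams) (g : ℕ → ℝ)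

/-- ★★★ **ONE PLAQUETTE WITH `2εreg ≤ |V′(∂q) − 1|` FORCES AN UNSOLVABLE χ₁-CUBE** (`εreg` in [B7] Prop. 2's range, grid `3·L·M₁ ≤ sideχ`, `1 ≤ M₁`, `1 ≤ m + K`): the cube of §1, by g8's
`not_solvable_of_roughAt` (a minimiser in def-R's class would make the cornered plaquettes of `□′^{∼3}` `2εreg`-regular). [cite: Balaban1988Convergent, (2.12)–(2.13) pp.256–257, (2.16) p.257; Balaban1985Averaging, Prop. 2 (52)–(54) p.26] -/
theorem exists_not_solvable_of_le_dist1 (hmK : 1 ≤ (F.P p.K).m + (F.P p.K).K) (hε : 0 < ν.εreg)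
    (hε3 : (143 * (((((F.P p.K).d + 4 : ℕ) : ℝ)) ^ 2 / 4) ^ 2) * ν.εreg ≤ 1 / 3)
    (hε2 : 2 * ν.εreg ≤ 2 * deltaSU (Fin N) / ((((F.P p.K).d + 4) * (F.P p.K).L : ℕ) : ℝ) ^ 2)
    (hM1 : 1 ≤ ν.M₁) (h3 : 3 * side (F.P p.K).L ν.M₁ 1 ≤ sideχ F ν p g 0)
    (V' : GaugeField (F.P p.K) 1 (SU N)) {q : Plaq (F.P p.K) 1} (hrough : 2 * ν.εreg ≤ dist1 (plaqHol V' q)) :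
    ∃ c : Iχ F ν p g 0, ¬ ∃ U₀, IsMinimizer (avOfRecord F N p.K) {U | PlaqSmall (ν.εreg * (F.P p.K).eta (0 + 1) ^ 2) U}
      (Bj ν.M₁ (cubeEnl (F.P p.K) (sideχ F ν p g 0) c 4) (0 + 1)) (avgFamily (avOfRecord F N p.K) (qsstarGIter0 (0 + 1) V')) U₀ := by
  have hχ : 0 < sideχ F ν p g 0 := by
    have : 0 < side (F.P p.K).L ν.M₁ 1 := by
      show 0 < (F.P p.K).L ^ 1 * ν.M₁; exact Nat.mul_pos (pow_pos (F.P p.K).L_pos 1) hM1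
    omega
  obtain ⟨c, h₀, hμ, hν⟩ := exists_cube_corners_mem_pts_three ν p g hχ (two_mul_L_le_of_grid ν p g hM1 h3) q
  exact ⟨c, not_solvable_of_roughAt ν p g 0 hmK hε hε3 hε2 hM1 h3 c V' h₀ hμ hν hrough⟩

/-- ★★★ **A `2εreg(Lη₁)²`-ROUGH COARSE FIELD HAS AN UNSOLVABLE χ₁-CUBE** — the rough set of g18 G∕H and g19 A–F at `α₀ = εreg` (`(Lη₁)² = 1`).
[cite: Balaban1988Convergent, (2.12)–(2.13) pp.256–257, (3.2) p.265; Balaban1985Averaging, Prop. 2 (52)–(54) p.26] -/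
theorem exists_not_solvable_of_not_plaqSmall (hmK : 1 ≤ (F.P p.K).m + (F.P p.K).K) (hε : 0 < ν.εreg)
    (hε3 : (143 * (((((F.P p.K).d + 4 : ℕ) : ℝ)) ^ 2 / 4) ^ 2) * ν.εreg ≤ 1 / 3)
    (hε2 : 2 * ν.εreg ≤ 2 * deltaSU (Fin N) / ((((F.P p.K).d + 4) * (F.P p.K).L : ℕ) : ℝ) ^ 2)
    (hM1 : 1 ≤ ν.M₁) (h3 : 3 * side (F.P p.K).L ν.M₁ 1 ≤ sideχ F ν p g 0)
    (V' : GaugeField (F.P p.K) 1 (SU N)) (hrough : ¬ PlaqSmall (2 * ν.εreg * (((F.P p.K).L : ℝ) ^ 1 * (F.P p.K).eta 1) ^ 2) V') :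
    ∃ c : Iχ F ν p g 0, ¬ ∃ U₀, IsMinimizer (avOfRecord F N p.K) {U | PlaqSmall (ν.εreg * (F.P p.K).eta (0 + 1) ^ 2) U}
      (Bj ν.M₁ (cubeEnl (F.P p.K) (sideχ F ν p g 0) c 4) (0 + 1)) (avgFamily (avOfRecord F N p.K) (qsstarGIter0 (0 + 1) V')) U₀ := by
  rw [L_mul_eta_one, one_pow, mul_one] at hrough
  unfold PlaqSmall at hrough
  push Not at hrough
  obtain ⟨q, hq⟩ := hrough
  exact exists_not_solvable_of_le_dist1 ν p g hmK hε hε3 hε2 hM1 h3 V' hq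

end Unsolvable

/-! ## §3. Where every cube is solvable no coarse field is rough: the test set of A–F lies on the unit branch -/

section SolvableBranch

variable (ν : Stage7Numerics) (M : ℕ) (p : B12.RunParams) (g : ℕ → ℝ)

/-- ★★★★ **EVERY CUBE SOLVABLE ⇒ THE COARSE FIELD IS `2εreg(Lη₁)²`-REGULAR** (contraposed §2). [cite: Balaban1988Convergent, (2.12)–(2.13) pp.256–257; Balaban1985Averaging, Prop. 2 (52)–(54) p.26] -/
theorem plaqSmall_of_forall_solvable (hmK : 1 ≤ (F.P p.K).m + (F.P p.K).K) (hε : 0 < ν.εreg)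
    (hε3 : (143 * (((((F.P p.K).d + 4 : ℕ) : ℝ)) ^ 2 / 4) ^ 2) * ν.εreg ≤ 1 / 3)
    (hε2 : 2 * ν.εreg ≤ 2 * deltaSU (Fin N) / ((((F.P p.K).d + 4) * (F.P p.K).L : ℕ) : ℝ) ^ 2)
    (hM1 : 1 ≤ ν.M₁) (h3 : 3 * side (F.P p.K).L ν.M₁ 1 ≤ sideχ F ν p g 0) (V' : GaugeField (F.P p.K) 1 (SU N))
    (hsolv : ∀ c : Iχ F ν p g 0, ∃ U₀, IsMinimizer (avOfRecord F N p.K) {U | PlaqSmall (ν.εreg * (F.P p.K).eta (0 + 1) ^ 2) U}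
      (Bj ν.M₁ (cubeEnl (F.P p.K) (sideχ F ν p g 0) c 4) (0 + 1)) (avgFamily (avOfRecord F N p.K) (qsstarGIter0 (0 + 1) V')) U₀) :
    PlaqSmall (2 * ν.εreg * (((F.P p.K).L : ℝ) ^ 1 * (F.P p.K).eta 1) ^ 2) V' := by
  by_contra hrough
  obtain ⟨c, hc⟩ := exists_not_solvable_of_not_plaqSmall ν p g hmK hε hε3 hε2 hM1 h3 V' hrough
  exact hc (hsolv c)

/-- ★★★★ **THE TEST SET OF g18 G∕H AND g19 A–F (AT `α₀ = εreg`) LIES ON def-R's UNIT BRANCH**: `{V′ | χ₁(s′)V′ ≠ 0 ∧ ¬PlaqSmall (2εreg(Lη₁)²) V′} ⊆ {V′ | ∃ □′, (2.12) unsolvable at (□′, V′)}`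
— for ANY history `s′` (the support conjunct is not even needed). [cite: Balaban1988Convergent, (2.12) p.256, (3.2) p.265; Balaban1985Averaging, Prop. 2 (52)–(54) p.26] -/
theorem rough_support_subset_unitBranch (hmK : 1 ≤ (F.P p.K).m + (F.P p.K).K) (hε : 0 < ν.εreg)
    (hε3 : (143 * (((((F.P p.K).d + 4 : ℕ) : ℝ)) ^ 2 / 4) ^ 2) * ν.εreg ≤ 1 / 3)
    (hε2 : 2 * ν.εreg ≤ 2 * deltaSU (Fin N) / ((((F.P p.K).d + 4) * (F.P p.K).L : ℕ) : ℝ) ^ 2)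
    (hM1 : 1 ≤ ν.M₁) (h3 : 3 * side (F.P p.K).L ν.M₁ 1 ≤ sideχ F ν p g 0) (s' : SeqOfRecord F ν M g p.K 1) :
    {V' : GaugeField (F.P p.K) 1 (SU N) | chiSeqOfRecord F N ν M g p.K 1 s' V' ≠ 0 ∧ ¬ PlaqSmall (2 * ν.εreg * (((F.P p.K).L : ℝ) ^ 1 * (F.P p.K).eta 1) ^ 2) V'} ⊆
      {V' | ∃ c : Iχ F ν p g 0, ¬ ∃ U₀, IsMinimizer (avOfRecord F N p.K) {U | PlaqSmall (ν.εreg * (F.P p.K).eta (0 + 1) ^ 2) U}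
        (Bj ν.M₁ (cubeEnl (F.P p.K) (sideχ F ν p g 0) c 4) (0 + 1)) (avgFamily (avOfRecord F N p.K) (qsstarGIter0 (0 + 1) V')) U₀} :=
  fun V' hV' => exists_not_solvable_of_not_plaqSmall ν p g hmK hε hε3 hε2 hM1 h3 V' hV'.2

/-- ★★★★ **… SO ITS INTERSECTION WITH «EVERY CUBE SOLVABLE» IS EMPTY**: the test of A–F is driven ONLY by the unit branch; a (3.2) indicator with a zero branch ∕ a solvability guard in the support
clause (repair (a′) of `…N11TopPairLocalResidual`'s census) has no rough field in its support. [cite: Balaban1988Convergent, (2.12) p.256, (3.2) p.265; Balaban1985Averaging, Prop. 2 (52)–(54) p.26] -/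
theorem solvable_rough_support_eq_empty (hmK : 1 ≤ (F.P p.K).m + (F.P p.K).K) (hε : 0 < ν.εreg)
    (hε3 : (143 * (((((F.P p.K).d + 4 : ℕ) : ℝ)) ^ 2 / 4) ^ 2) * ν.εreg ≤ 1 / 3)
    (hε2 : 2 * ν.εreg ≤ 2 * deltaSU (Fin N) / ((((F.P p.K).d + 4) * (F.P p.K).L : ℕ) : ℝ) ^ 2)
    (hM1 : 1 ≤ ν.M₁) (h3 : 3 * side (F.P p.K).L ν.M₁ 1 ≤ sideχ F ν p g 0) (s' : SeqOfRecord F ν M g p.K 1) :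
    {V' : GaugeField (F.P p.K) 1 (SU N) |
        (∀ c : Iχ F ν p g 0, ∃ U₀, IsMinimizer (avOfRecord F N p.K) {U | PlaqSmall (ν.εreg * (F.P p.K).eta (0 + 1) ^ 2) U}
          (Bj ν.M₁ (cubeEnl (F.P p.K) (sideχ F ν p g 0) c 4) (0 + 1)) (avgFamily (avOfRecord F N p.K) (qsstarGIter0 (0 + 1) V')) U₀) ∧
        chiSeqOfRecord F N ν M g p.K 1 s' V' ≠ 0 ∧ ¬ PlaqSmall (2 * ν.εreg * (((F.P p.K).L : ℝ) ^ 1 * (F.P p.K).eta 1) ^ 2) V'} = ∅ := by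
  ext V'
  simp only [Set.mem_setOf_eq, Set.mem_empty_iff_false, iff_false, not_and, not_not]
  intro hsolv _
  exact plaqSmall_of_forall_solvable ν p g hmK hε hε3 hε2 hM1 h3 V' hsolv

end SolvableBranch

end Summit.QuantumFields.YangMills.Theorems.BalabanUVNodesN11RoughSupportOnUnitBranch

end
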